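import Literature.Geometry.Lorentzian.LandauLifshitzPseudotensor
import Mathlib.Analysis.InnerProductSpace.PiL2

/-!
# Route EIHFluxBalance — `EIHFluxEvaluation` (c): the linearised vacuum equation at flat space
# along a family `η + sK` of Ricci-flat components

Helper file (`--supports stmt-FinalStateConjecture-10188`). Coordinate tensor calculus
(`Literature.Geometry.Lorentzian.CoordCurvature`, O'Neill 1983 Ch. 3) of the one-parameter family
of components `g_s = η + s K` on an open set `V ⊆ E4`, `K` of class `C^∞` on `V` (no Kerr–Schild
structure is used in this file):

* `D(g_s) = s DK`, `D²(g_s) = s D²K`, Koszul form `𝒦(g_s) = s 𝒦(K)` (`fderiv_ksFamily`,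
  `fderiv_fderiv_ksFamily`, `koszulCLM_ksFamily`);
* products of Christoffel maps are `O(s²)`: `g_s(Γ_s(P,Q), Γ_s(R,U)) = s²/4 · 𝒦(K)(P,Q,♯_s 𝒦(K)(R,U))`
  (`apply_chrAt_chrAt_ksFamily`), so the first-kind curvature form
  (`IsMetricOn.apply_riemAt`) reads `g_s(R_s(X,Y)Z, W) = s/2 · 𝒫(D²K) + s² · (…)`
  (`apply_riemAt_ksFamily`);
* **linearised vacuum equation** (`ricci_linearization`): if `g_s` is a metric on `V` with
  `Ric(g_s)(x) = 0` for all `s` in a set `S` accumulating at `0`, then the flat-space linearisation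
  of the Ricci tensor in the direction `K` vanishes at `x`:
  `Σ_{ij} η^{ij} (T_{iabj} + T_{ibja} − T_{ijab} − T_{aibj} − T_{abji} + T_{ajib}) = 0` for all `a, b`,
  `T_{ijkl} = D²K(x)(∂_i,∂_j)(∂_k,∂_l)` — O'Neill's formula `Ric = Σ g^{ij} G(R(∂_i,·)·, ∂_j)`
  (`ricAt_eq_sum_ginv`) divided by `s` and sent to `s → 0` (continuity of `A ↦ A⁻¹` at `η`). This is
  exactly the `T`-linear "principal part" of `R_{ab}` entering
  `Literature.…LandauLifshitz.principalPart_cancel` with `U = diag(−1,1,1,1)`.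

Reference for the linearisation of `Ric` at a background along `g + sγ`: Wald 1984, §7.5,
(7.5.7)–(7.5.14) (here at the flat background in global inertial coordinates, (4.4.10)).
-/

noncomputable section

open Filter Set
open scoped Matrix Topology ContDiff

namespace Summit.FinalStateConjecture.FinalStateConjecture.Theorems

namespace KSFlux

open Literature.Geometry.Lorentzian Literature.Geometry.Lorentzian.LandauLifshitz
set_option maxSynthPendingDepth 3

variable {K : E4 → E4 →L[ℝ] E4 →L[ℝ] ℝ}

section Linearization

variable {V : Set E4} {x y : E4}

/-- `D(η + sK)(y) = s · DK(y)` at the points of `V`. [folklore] -/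
theorem fderiv_ksFamily (hV : IsOpen V) (hK : ContDiffOn ℝ ∞ K V) (hy : y ∈ V) (s : ℝ) :
    fderiv ℝ (fun z ↦ Minkowski.bilin + s • K z) y = s • fderiv ℝ K y := by
  rw [fderiv_const_add,
    fderiv_fun_const_smul (((hK y hy).contDiffAt (hV.mem_nhds hy)).differentiableAt (by simp))]

/-- `D²(η + sK)(x) = s · D²K(x)` at the points of `V`. [folklore] -/
theorem fderiv_fderiv_ksFamily (hV : IsOpen V) (hK : ContDiffOn ℝ ∞ K V) (hx : x ∈ V) (s : ℝ) :
    fderiv ℝ (fderiv ℝ (fun z ↦ Minkowski.bilin + s • K z)) x = s • fderiv ℝ (fderiv ℝ K) x := by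
  have heq : fderiv ℝ (fun z ↦ Minkowski.bilin + s • K z) =ᶠ[𝓝 x] fun y ↦ s • fderiv ℝ K y :=
    Filter.eventually_of_mem (hV.mem_nhds hx) fun y hy ↦ fderiv_ksFamily hV hK hy s
  rw [heq.fderiv_eq, fderiv_fun_const_smul ((((hK.fderiv_of_isOpen hV (m := ∞) (by simp)) x
    hx).contDiffAt (hV.mem_nhds hx)).differentiableAt (by simp))]

/-- The Koszul form of the family: `𝒦(η + sK)(y) = s · koszulOp (DK(y))`.
[cite: ONeill1983, Ch. 3, Prop. 3.13] -/
theorem koszulCLM_ksFamily (hV : IsOpen V) (hK : ContDiffOn ℝ ∞ K V) (hy : y ∈ V) (s : ℝ) :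
    MetricCoord.koszulCLM (fun z ↦ Minkowski.bilin + s • K z) y = s • MetricCoord.koszulOp (fderiv
        ℝ K y) := by
  rw [MetricCoord.koszulCLM, fderiv_ksFamily hV hK hy s, map_smul]

/-- **Products of Christoffel maps of the family are `O(s²)`**:
`g_s(Γ_s(P,Q), Γ_s(R,U)) = s² · ¼ 𝒦(K)(P, Q, ♯_s 𝒦(K)(R, U))` (`Γ = ½ ♯ 𝒦`, `𝒦(g_s) = s 𝒦(K)`).
[cite: ONeill1983, Ch. 3, Prop. 3.13] -/
theorem apply_chrAt_chrAt_ksFamily {s : ℝ} (hG : MetricCoord.IsMetricOn (fun z ↦ Minkowski.bilin +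
    s • K z) V)
    (hK : ContDiffOn ℝ ∞ K V) (hx : x ∈ V) (P Q R U : E4) :
    (Minkowski.bilin + s • K x) (MetricCoord.chrAt (fun z ↦ Minkowski.bilin + s • K z) x P Q)
        (MetricCoord.chrAt (fun z ↦ Minkowski.bilin + s • K z) x R U) =
      s ^ 2 * (4⁻¹ * MetricCoord.koszulOp (fderiv ℝ K x) P Q
        (MetricCoord.sharpAt (fun z ↦ Minkowski.bilin + s • K z) x (MetricCoord.koszulOp (fderiv ℝ
            K x) R U))) := by
  rw [MetricCoord.apply_chrAt (G := (fun z ↦ Minkowski.bilin + s • K z)) (hG.isInvertible x hx) P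
      Q, MetricCoord.chrAt_apply,
    koszulCLM_ksFamily hG.isOpen hK hx s]
  simp only [map_smul, FunLike.coe_smul, Pi.smul_apply, smul_eq_mul]
  ring

/-- **The first-kind curvature form along the family**: for `g_s = η + sK` a metric on `V`,
`g_s(R_s(X,Y)Z, W) = s/2 · (D²K(X,Y)(Z,W) + D²K(X,Z)(W,Y) − D²K(X,W)(Y,Z) − D²K(Y,X)(Z,W)
 − D²K(Y,Z)(W,X) + D²K(Y,W)(X,Z)) + s² · ¼ (−𝒦(Y,Z,♯_s𝒦(X,W)) + 𝒦(X,Z,♯_s𝒦(Y,W)))`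
(O'Neill 1983, Ch. 3, Lemma 3.38 in first-kind form, `IsMetricOn.apply_riemAt`).
[cite: ONeill1983, Ch. 3, Lemma 3.38] -/
theorem apply_riemAt_ksFamily {s : ℝ} (hG : MetricCoord.IsMetricOn (fun z ↦ Minkowski.bilin + s • K
    z) V)
    (hK : ContDiffOn ℝ ∞ K V) (hx : x ∈ V) (X Y Z W : E4) :
    (Minkowski.bilin + s • K x) (MetricCoord.riemAt (fun z ↦ Minkowski.bilin + s • K z) x X Y Z) W =
      s * (2⁻¹ * (fderiv ℝ (fderiv ℝ K) x X Y Z W + fderiv ℝ (fderiv ℝ K) x X Z W Y -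
          fderiv ℝ (fderiv ℝ K) x X W Y Z - (fderiv ℝ (fderiv ℝ K) x Y X Z W +
          fderiv ℝ (fderiv ℝ K) x Y Z W X - fderiv ℝ (fderiv ℝ K) x Y W X Z))) +
      s ^ 2 * (4⁻¹ * (-(MetricCoord.koszulOp (fderiv ℝ K x) Y Z
          (MetricCoord.sharpAt (fun z ↦ Minkowski.bilin + s • K z) x (MetricCoord.koszulOp (fderiv
              ℝ K x) X W))) +
        MetricCoord.koszulOp (fderiv ℝ K x) X Z
          (MetricCoord.sharpAt (fun z ↦ Minkowski.bilin + s • K z) x (MetricCoord.koszulOp (fderiv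
              ℝ K x) Y W)))) := by
  rw [hG.apply_riemAt hx, hG.fderiv_koszulCLM_apply₃ hx, hG.fderiv_koszulCLM_apply₃ hx,
    fderiv_fderiv_ksFamily hG.isOpen hK hx s, apply_chrAt_chrAt_ksFamily hG hK hx,
    apply_chrAt_chrAt_ksFamily hG hK hx]
  simp only [FunLike.coe_smul, Pi.smul_apply, smul_eq_mul]
  ring

/-- **Index raising with `η` in the coordinate basis**: `η⁻¹(dxʲ) = η^{jj} ∂_j`, i.e. the inverse
metric coefficients of `η` are `diag(−1,1,1,1)`. [cite: ONeill1983, Ch. 3, p. 55] -/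
theorem coord_inverse_minkowski (i j : Fin 4) :
    MetricCoord.coordCLM (EuclideanSpace.basisFun (Fin 4) ℝ).toBasis i
        ((Minkowski.bilin).inverse
          (MetricCoord.coordCLM (EuclideanSpace.basisFun (Fin 4) ℝ).toBasis j)) = (Matrix.diagonal
              ![(-1 : ℝ), 1, 1, 1]) i j := by
  have hsharp : (Minkowski.bilin).inverse
      (MetricCoord.coordCLM (EuclideanSpace.basisFun (Fin 4) ℝ).toBasis j) =
        (![(-1 : ℝ), 1, 1, 1] : Fin 4 → ℝ) j • E4.basisVector j := by
    refine MetricCoord.sharpAt_eq_of_forall (G := fun _ : E4 ↦ Minkowski.bilin) (x := (0 : E4))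
      (MetricCoord.isInvertible_of_nondegenerate Minkowski.bilin_nondegenerate) fun w ↦ ?_
    rw [MetricCoord.coordCLM_apply, Module.Basis.coord_apply,
      OrthonormalBasis.coe_toBasis_repr_apply, EuclideanSpace.basisFun_repr, map_smul,
      FunLike.coe_smul, Pi.smul_apply, smul_eq_mul]
    fin_cases j <;> simp [Fin.sum_univ_three, Fin.succ_ne_zero]
  rw [hsharp, map_smul, MetricCoord.coordCLM_apply, Module.Basis.coord_apply,
    OrthonormalBasis.coe_toBasis_repr_apply, EuclideanSpace.basisFun_repr, smul_eq_mul]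
  fin_cases i <;> fin_cases j <;> simp [Matrix.diagonal]

/-- **The linearised vacuum equation at flat space along a family of Ricci-flat components.**
Let `K` be `C^∞` on the open set `V ∋ x` and suppose that for every `s` in a set `S ⊆ ℝ` with
`0 ∈ closure (S ∖ {0})` the components `g_s = η + sK` form a metric on `V` with `Ric(g_s)(x) = 0`.
Then the second derivatives `T_{ijkl} = D²K(x)(∂_i,∂_j)(∂_k,∂_l)` satisfy, for all `a b`,
`Σ_{ij} η^{ij} (T_{iabj} + T_{ibja} − T_{ijab} − T_{aibj} − T_{abji} + T_{ajib}) = 0`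
(twice the `s`-derivative at `0` of `Ric(g_s)(∂_a,∂_b) = Σ g_s^{ij} g_s(R_s(∂_i,∂_a)∂_b, ∂_j)`;
Wald 1984, (7.5.14) at the flat background). Stated for any array `T` with the displayed entries.
[cite: Wald1984GR, §7.5 (7.5.14)] -/
theorem ricci_linearization (hK : ContDiffOn ℝ ∞ K V) (hx : x ∈ V) {S : Set ℝ}
    (hmet : ∀ s ∈ S, MetricCoord.IsMetricOn (fun z ↦ Minkowski.bilin + s • K z) V)
    (hvac : ∀ s ∈ S, MetricCoord.ricAt (fun z ↦ Minkowski.bilin + s • K z) x = 0) (hS : (0 : ℝ) ∈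
        closure (S \ {0}))
    (T : Fin 4 → Fin 4 → Fin 4 → Fin 4 → ℝ)
    (hT : ∀ i j k l, T i j k l = fderiv ℝ (fderiv ℝ K) x (E4.basisVector i) (E4.basisVector j)
      (E4.basisVector k) (E4.basisVector l))
    (a b : Fin 4) :
    ∑ i : Fin 4, ∑ j : Fin 4, (Matrix.diagonal ![(-1 : ℝ), 1, 1, 1]) i j *
      (T i a b j + T i b j a - T i j a b - T a i b j - T a b j i + T a j i b) = 0 := by
  set bs := (EuclideanSpace.basisFun (Fin 4) ℝ).toBasis with hbs
  have hb : ∀ i, bs i = E4.basisVector i := fun i ↦ by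
    rw [hbs, OrthonormalBasis.coe_toBasis, EuclideanSpace.basisFun_apply]
  -- the inverse along the family, the Koszul operator of `DK(x)` and the reduced component
  set sh : ℝ → (E4 →L[ℝ] ℝ) →L[ℝ] E4 := fun s ↦ (Minkowski.bilin + s • K x).inverse with hsh
  set Kz := MetricCoord.koszulOp (fderiv ℝ K x) with hKz
  set f : ℝ → ℝ := fun s ↦ ∑ i : Fin 4, ∑ j : Fin 4,
    MetricCoord.coordCLM bs i (sh s (MetricCoord.coordCLM bs j)) *
      (2⁻¹ * (T i a b j + T i b j a - T i j a b - T a i b j - T a b j i + T a j i b) +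
        s * (4⁻¹ * (-(Kz (E4.basisVector a) (E4.basisVector b)
            (sh s (Kz (E4.basisVector i) (E4.basisVector j)))) +
          Kz (E4.basisVector i) (E4.basisVector b)
            (sh s (Kz (E4.basisVector a) (E4.basisVector j)))))) with hf
  -- (A) `Ric(g_s)(∂_a, ∂_b) = s · f s` for `s ∈ S`
  have hA : ∀ s ∈ S, MetricCoord.ricAt (fun z ↦ Minkowski.bilin + s • K z) x (E4.basisVector a)
      (E4.basisVector b) = s * f s := by
    intro s hs
    have hG := hmet s hs
    rw [MetricCoord.ricAt_eq_sum_ginv bs (hG.isInvertible x hx)]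
    simp only [hf]
    rw [Finset.mul_sum]
    refine Finset.sum_congr rfl fun i _ ↦ ?_
    rw [Finset.mul_sum]
    refine Finset.sum_congr rfl fun j _ ↦ ?_
    have hgi : MetricCoord.ginv (fun z ↦ Minkowski.bilin + s • K z) bs x i j =
        MetricCoord.coordCLM bs i (sh s (MetricCoord.coordCLM bs j)) := rfl
    rw [hgi, hb, hb, apply_riemAt_ksFamily hG hK hx]
    have hsh' : MetricCoord.sharpAt (fun z ↦ Minkowski.bilin + s • K z) x = sh s := rfl
    simp only [hT, hsh', ← hKz]
    ring
  -- (B) `f` is continuous at `0` (inversion is continuous at the invertible `η`)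
  have hsh0 : ContinuousAt sh 0 := by
    have h0 : (Minkowski.bilin + (0 : ℝ) • K x).IsInvertible := by
      rw [zero_smul, add_zero]
      exact MetricCoord.isInvertible_of_nondegenerate Minkowski.bilin_nondegenerate
    have h1 : ContinuousAt (fun s : ℝ ↦ Minkowski.bilin + s • K x) 0 := by fun_prop
    have h2 : ContinuousAt ContinuousLinearMap.inverse
        ((fun s : ℝ ↦ Minkowski.bilin + s • K x) 0) :=
      (h0.contDiffAt_map_inverse (n := 0)).continuousAt
    exact ContinuousAt.comp (g := ContinuousLinearMap.inverse)
      (f := fun s : ℝ ↦ Minkowski.bilin + s • K x) h2 h1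
  have hc : ∀ (L : E4 →L[ℝ] ℝ) (w : E4 →L[ℝ] ℝ), ContinuousAt (fun s ↦ L (sh s w)) 0 :=
    fun L w ↦ L.continuous.continuousAt.comp (hsh0.clm_apply continuousAt_const)
  have hB : ContinuousAt f 0 := by
    rw [hf]
    refine tendsto_finsetSum _ fun i _ ↦ tendsto_finsetSum _ fun j _ ↦ ?_
    exact (hc _ _).mul (continuousAt_const.add (continuousAt_id.mul (continuousAt_const.mul
      (((hc _ _).neg).add (hc _ _)))))
  -- (C) `f = 0` on `S ∖ {0}`, hence `f 0 = 0`
  have hC : ∀ s ∈ S \ {0}, f s = (fun _ : ℝ ↦ (0 : ℝ)) s := by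
    rintro s ⟨hs, hs0⟩
    have h := hA s hs
    rw [hvac s hs, zero_apply, zero_apply] at h
    exact (mul_eq_zero.mp h.symm).resolve_left hs0
  have hf0 : f 0 = 0 :=
    tendsto_nhds_unique_of_frequently_eq hB tendsto_const_nhds
      ((mem_closure_iff_frequently.mp hS).mono hC)
  -- (D) `f 0 = ½ Σ η^{ij} (…)`
  have hD : f 0 = 2⁻¹ * ∑ i : Fin 4, ∑ j : Fin 4, (Matrix.diagonal ![(-1 : ℝ), 1, 1, 1]) i j *
      (T i a b j + T i b j a - T i j a b - T a i b j - T a b j i + T a j i b) := by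
    have h00 : sh 0 = (Minkowski.bilin).inverse := by
      simp only [hsh, zero_smul, add_zero]
    simp only [hf, zero_mul, add_zero, h00, hbs, coord_inverse_minkowski, Finset.mul_sum]
    refine Finset.sum_congr rfl fun i _ ↦ Finset.sum_congr rfl fun j _ ↦ ?_
    ring
  rw [hD] at hf0
  linarith

end Linearization

end KSFlux

end Summit.FinalStateConjecture.FinalStateConjecture.Theorems

end
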